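import Literature.MathematicalPhysics.QuantumLattice.HubbardTTPrimeThermalPressureLimit
import Literature.MathematicalPhysics.QuantumLattice.TorusSectorGibbsEntropyRowPressureFloorsAllTori
import HarnessLib

/-!
# Entropy rows keyed to the thermal pressure NUMBER `p(β; t,t',U; n)`: a floor along ONE side sequence is a
# floor on the number, hence a floor along EVERY side sequence

Topic `MathematicalPhysics/QuantumLattice` (family `hubbard`; `T > 0` certificate family, the `f⁺` input row of
the entropy rows «ent» / «cent»). Companion of `TorusSectorGibbsEntropyRowPressureInput.lean`,
`TorusSectorGibbsCondEntropyRowPressureInput.lean` (hubbard-thermal p1) and of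
`HubbardTTPrimeThermalPressureLimit.lean` (hubbard-box p1: the limit
`ThermodynamicLimit.pressureTT' β t t' U n = lim_L L⁻² log Re Z_β(sectorHamiltonianTT' t t' U n L)` EXISTS for
`β ≥ 0`, `U ≥ 0`, `0 ≤ n < 2`).

Up to now every pressure-floor input of a row had to be supplied ALONG THE SIDE SEQUENCE `Ls` defining the torus
limit `ω` (`hW : ∀ ε > 0, ∀ᶠ j, (W − ε)(Ls j)² ≤ log Re Z_β^{sector}(Ls j)`), and box-built certificates, which
hold only on box-compatible tori, needed the filling-box combinatorics of `…PressureFloorsAllTori` to reach every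
`Ls`. Since the limit exists, this bookkeeping disappears:

* §1 THE SUBSEQUENCE DICTIONARY (`ThermodynamicLimit`, `β ≥ 0`, `U ≥ 0`, `0 ≤ n < 2`): a floor in the `hW` shape
  along ONE divergent side sequence — or merely FREQUENTLY in `L` — is the bound `W ≤ pressureTT' β t t' U n`
  (`le_pressureTT'_of_eventually_subseq`, `le_pressureTT'_of_frequently`, plain no-`ε` forms), and conversely
  `W ≤ pressureTT'` gives the `hW` shape along EVERY `Ls → ∞` (`le_pressureTT'_iff_subseq`,
  `eventually_pressureFloor_subseq_of_subseq`); the same for ceilings (`pressureTT'_le_of_eventually_subseq`,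
  `pressureTT'_le_of_frequently`, `pressureTT'_le_iff_subseq`, `eventually_pressureCeiling_subseq_of_subseq`);
* §2 the box certificates AS NUMBERS: one open-box sector floor `log z/(ab) ≤ p`, the purity-box floor
  `−(log P + βE)/(ab) ≤ p`, the two-box chord;
* §3 THE ROWS ON THE NUMBER (`InfVolFermionState.IsTorusLimitOfMixture.…`): for every torus limit `ω` of the
  canonical sector Gibbs states at `β > 0` along any `Ls → ∞`, the «ent» row in its sharp form
  `e_Φ(ω) − Re ω_B(G)/(β|B|) ≤ −p(β)/β + log Re Tr e^{−G}/(β|B|)` (the Gibbs variational inequality `e − T·s ≤ f(β)`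
  with the entropy cap of the witness `G`, `f(β) = −p(β)/β` the canonical free energy per site) and with any
  `W ≤ p(β)` (`…_box_pressureTT'`, `…_box_of_le_pressureTT'`), its reader shape
  (`re_expect_entRow_nonneg_of_sectorGibbs_of_le_pressureTT'`); the «cent» row likewise
  (`…_window_pressureTT'`, `…_window_of_le_pressureTT'`, `re_expect_centRow_nonneg_of_sectorGibbs_of_le_pressureTT'`)
  and its two certificate instances (Löwner dual certificate `(L_B, c)`, Lieb constant).

So a producer's `f⁺` input at `T > 0` is ONE row `W ≤ pressureTT' β t t' U n` keyed to a defined constant — exactly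
like a `T = 0` input row `energyDensityTT' t t' U n ≤ f` — whatever tori certified it.
Everything is PROVED; no definition, no named fact.

REUSED: `tendsto_sectorPressureTT'`, `tendsto_log_partitionFn_div_sq_comp`, `pressureTT'_mem_Icc`,
`eventually_sub_mul_sq_le_log_partitionFn_of_le_pressureTT'` (`HubbardTTPrimeThermalPressureLimit`); the
`…_allTori` floors (`TorusSectorGibbsEntropyRowPressureFloorsAllTori`); the `…_of_pressureFloor` rows; Mathlib
`ge_of_tendsto`, `le_of_tendsto`, `IsClosed.mem_of_frequently_of_tendsto`, `le_of_forall_sub_le`.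

## References

Israel 1979 Thm. I.2.4 (the pressure), Lemma II.3.1 (variational principle) [cite: Israel1979, Thm. I.2.4];
Ruelle 1969 §3.3–3.4 [cite: Ruelle1969, §3.4]; Araki–Moriya 2003 Thm. 3.8/§10 [cite: ArakiMoriya2003, Theorem 3.8 and §10];
Poulin–Hastings 2011 eqs. (3)–(8) [cite: PoulinHastings2011, eqs. (3)–(8)].
-/

noncomputable section

namespace Literature.MathematicalPhysics.QuantumLattice

open Matrix Finset HubbardWave0 Literature.Probability.LatticeModels ThermodynamicLimit
open Literature.InformationTheory.Entropy (vonNeumannEntropy)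
open Literature.LinearAlgebra.Matrix (logFrechet)
open _root_.Filter
open scoped _root_.Topology ComplexOrder BigOperators

namespace ThermodynamicLimit

section Dictionary

variable {β : ℝ} (hβ : 0 ≤ β) (t t' : ℝ) {U : ℝ} (hU : 0 ≤ U) {n : ℝ} (hn0 : 0 ≤ n) (hn2 : n < 2)
include hβ hU hn0 hn2

/-! ### §1 Floors / ceilings along ONE side sequence (or frequently) are bounds on the number -/

/-- **A pressure floor along ONE divergent side sequence is a floor on the number.** If `Ls → ∞` and for every
`ε > 0`, eventually in `j`, `(W − ε)(Ls j)² ≤ log Re Z_β(sectorHamiltonianTT' t t' U n (Ls j))`, then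
`W ≤ p(β; t,t',U; n)` (`β ≥ 0`, `U ≥ 0`, `0 ≤ n < 2`; the limit exists, so its value is read off any subsequence).
[cite: Israel1979, Thm. I.2.4] -/
theorem le_pressureTT'_of_eventually_subseq {Ls : ℕ → ℕ} (hLs : Tendsto Ls atTop atTop) {W : ℝ}
    (hW : ∀ ε : ℝ, 0 < ε → ∀ᶠ j in atTop,
      (W - ε) * (Ls j : ℝ) ^ 2 ≤ Real.log (partitionFn β (sectorHamiltonianTT' t t' U n (Ls j))).re) :
    W ≤ pressureTT' β t t' U n := by
  refine le_of_forall_sub_le fun ε hε => ?_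
  refine ge_of_tendsto (tendsto_log_partitionFn_div_sq_comp hβ t t' hU hn0 hn2 hLs) ?_
  filter_upwards [hW ε hε, hLs.eventually_ge_atTop 1] with j hj hj1
  have hL : (1 : ℝ) ≤ (Ls j : ℝ) := by exact_mod_cast hj1
  have hL2 : (0 : ℝ) < (Ls j : ℝ) ^ 2 := by positivity
  rwa [le_div_iff₀ hL2]

/-- **A pressure floor on INFINITELY MANY tori is a floor on the number.** If for every `ε > 0`, frequently in `L`,
`(W − ε) L² ≤ log Re Z_β(sectorHamiltonianTT' t t' U n L)`, then `W ≤ p(β; t,t',U; n)`. [cite: Israel1979, Thm. I.2.4] -/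
theorem le_pressureTT'_of_frequently {W : ℝ}
    (hW : ∀ ε : ℝ, 0 < ε → ∃ᶠ L : ℕ in atTop,
      (W - ε) * (L : ℝ) ^ 2 ≤ Real.log (partitionFn β (sectorHamiltonianTT' t t' U n L)).re) :
    W ≤ pressureTT' β t t' U n := by
  refine le_of_forall_sub_le fun ε hε => ?_
  have hfr : ∃ᶠ L : ℕ in atTop, sectorPressureTT' β t t' U n L ∈ Set.Ici (W - ε) := by
    refine ((hW ε hε).and_eventually (eventually_ge_atTop 1)).mono fun L hL => ?_
    have h1 : (1 : ℝ) ≤ (L : ℝ) := by exact_mod_cast hL.2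
    have hL2 : (0 : ℝ) < (L : ℝ) ^ 2 := by positivity
    rw [Set.mem_Ici, sectorPressureTT', le_div_iff₀ hL2]
    exact hL.1
  exact isClosed_Ici.mem_of_frequently_of_tendsto hfr (tendsto_sectorPressureTT' hβ t t' hU hn0 hn2)

/-- Plain form: an exact floor `W (Ls j)² ≤ log Re Z(Ls j)` eventually along one `Ls → ∞` gives `W ≤ p`.
[cite: Israel1979, Thm. I.2.4] -/
theorem le_pressureTT'_of_eventually_subseq_mul_sq_le {Ls : ℕ → ℕ} (hLs : Tendsto Ls atTop atTop) {W : ℝ}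
    (hW : ∀ᶠ j in atTop, W * (Ls j : ℝ) ^ 2 ≤ Real.log (partitionFn β (sectorHamiltonianTT' t t' U n (Ls j))).re) :
    W ≤ pressureTT' β t t' U n :=
  le_pressureTT'_of_eventually_subseq hβ t t' hU hn0 hn2 hLs fun _ hε =>
    hW.mono fun _ hL => le_trans (mul_le_mul_of_nonneg_right (sub_le_self W hε.le) (sq_nonneg _)) hL

/-- Plain form: an exact floor `W L² ≤ log Re Z(L)` on infinitely many tori gives `W ≤ p`. [cite: Israel1979, Thm. I.2.4] -/
theorem le_pressureTT'_of_frequently_mul_sq_le {W : ℝ}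
    (hW : ∃ᶠ L : ℕ in atTop, W * (L : ℝ) ^ 2 ≤ Real.log (partitionFn β (sectorHamiltonianTT' t t' U n L)).re) :
    W ≤ pressureTT' β t t' U n :=
  le_pressureTT'_of_frequently hβ t t' hU hn0 hn2 fun _ hε =>
    hW.mono fun _ hL => le_trans (mul_le_mul_of_nonneg_right (sub_le_self W hε.le) (sq_nonneg _)) hL

/-- **A pressure ceiling along ONE divergent side sequence is a ceiling on the number.** If `Ls → ∞` and for
every `ε > 0`, eventually `log Re Z_β(sectorHamiltonianTT' t t' U n (Ls j)) ≤ (u + ε)(Ls j)²`, then `p ≤ u`.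
[cite: Israel1979, Thm. I.2.4] -/
theorem pressureTT'_le_of_eventually_subseq {Ls : ℕ → ℕ} (hLs : Tendsto Ls atTop atTop) {u : ℝ}
    (hu : ∀ ε : ℝ, 0 < ε → ∀ᶠ j in atTop,
      Real.log (partitionFn β (sectorHamiltonianTT' t t' U n (Ls j))).re ≤ (u + ε) * (Ls j : ℝ) ^ 2) :
    pressureTT' β t t' U n ≤ u := by
  refine le_of_forall_pos_le_add fun ε hε => ?_
  refine le_of_tendsto (tendsto_log_partitionFn_div_sq_comp hβ t t' hU hn0 hn2 hLs) ?_
  filter_upwards [hu ε hε, hLs.eventually_ge_atTop 1] with j hj hj1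
  have hL : (1 : ℝ) ≤ (Ls j : ℝ) := by exact_mod_cast hj1
  have hL2 : (0 : ℝ) < (Ls j : ℝ) ^ 2 := by positivity
  rwa [div_le_iff₀ hL2]

/-- **A pressure ceiling on INFINITELY MANY tori is a ceiling on the number.** [cite: Israel1979, Thm. I.2.4] -/
theorem pressureTT'_le_of_frequently {u : ℝ}
    (hu : ∀ ε : ℝ, 0 < ε → ∃ᶠ L : ℕ in atTop,
      Real.log (partitionFn β (sectorHamiltonianTT' t t' U n L)).re ≤ (u + ε) * (L : ℝ) ^ 2) :
    pressureTT' β t t' U n ≤ u := by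
  refine le_of_forall_pos_le_add fun ε hε => ?_
  have hfr : ∃ᶠ L : ℕ in atTop, sectorPressureTT' β t t' U n L ∈ Set.Iic (u + ε) := by
    refine ((hu ε hε).and_eventually (eventually_ge_atTop 1)).mono fun L hL => ?_
    have h1 : (1 : ℝ) ≤ (L : ℝ) := by exact_mod_cast hL.2
    have hL2 : (0 : ℝ) < (L : ℝ) ^ 2 := by positivity
    rw [Set.mem_Iic, sectorPressureTT', div_le_iff₀ hL2]
    exact hL.1
  exact isClosed_Iic.mem_of_frequently_of_tendsto hfr (tendsto_sectorPressureTT' hβ t t' hU hn0 hn2)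

/-- Plain form: an exact ceiling `log Re Z(Ls j) ≤ u (Ls j)²` eventually along one `Ls → ∞` gives `p ≤ u`.
[cite: Israel1979, Thm. I.2.4] -/
theorem pressureTT'_le_of_eventually_subseq_le_mul_sq {Ls : ℕ → ℕ} (hLs : Tendsto Ls atTop atTop) {u : ℝ}
    (hu : ∀ᶠ j in atTop, Real.log (partitionFn β (sectorHamiltonianTT' t t' U n (Ls j))).re ≤ u * (Ls j : ℝ) ^ 2) :
    pressureTT' β t t' U n ≤ u :=
  pressureTT'_le_of_eventually_subseq hβ t t' hU hn0 hn2 hLs fun _ hε =>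
    hu.mono fun _ hL => hL.trans (mul_le_mul_of_nonneg_right (le_add_of_nonneg_right hε.le) (sq_nonneg _))

/-- **The `hW` shape along a side sequence IS the bound on the number**: for every `Ls → ∞`,
`W ≤ p ↔ ∀ ε > 0, ∀ᶠ j, (W − ε)(Ls j)² ≤ log Re Z_β^{sector}(Ls j)`. [cite: Israel1979, Thm. I.2.4] -/
theorem le_pressureTT'_iff_subseq {Ls : ℕ → ℕ} (hLs : Tendsto Ls atTop atTop) {W : ℝ} :
    W ≤ pressureTT' β t t' U n ↔ ∀ ε : ℝ, 0 < ε → ∀ᶠ j in atTop,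
      (W - ε) * (Ls j : ℝ) ^ 2 ≤ Real.log (partitionFn β (sectorHamiltonianTT' t t' U n (Ls j))).re :=
  ⟨fun h _ hε => eventually_sub_mul_sq_le_log_partitionFn_of_le_pressureTT' hβ t t' hU hn0 hn2 h hLs hε,
    le_pressureTT'_of_eventually_subseq hβ t t' hU hn0 hn2 hLs⟩

/-- **The `hu` shape along a side sequence IS the bound on the number**: for every `Ls → ∞`,
`p ≤ u ↔ ∀ ε > 0, ∀ᶠ j, log Re Z_β^{sector}(Ls j) ≤ (u + ε)(Ls j)²`. [cite: Israel1979, Thm. I.2.4] -/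
theorem pressureTT'_le_iff_subseq {Ls : ℕ → ℕ} (hLs : Tendsto Ls atTop atTop) {u : ℝ} :
    pressureTT' β t t' U n ≤ u ↔ ∀ ε : ℝ, 0 < ε → ∀ᶠ j in atTop,
      Real.log (partitionFn β (sectorHamiltonianTT' t t' U n (Ls j))).re ≤ (u + ε) * (Ls j : ℝ) ^ 2 :=
  ⟨fun h _ hε => eventually_log_partitionFn_le_add_mul_sq_of_pressureTT'_le hβ t t' hU hn0 hn2 h hLs hε,
    pressureTT'_le_of_eventually_subseq hβ t t' hU hn0 hn2 hLs⟩

/-- **Floor along one `Ls` ⇒ floor along every `Ls'`.** [cite: Israel1979, Thm. I.2.4] -/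
theorem eventually_pressureFloor_subseq_of_subseq {Ls Ls' : ℕ → ℕ} (hLs : Tendsto Ls atTop atTop)
    (hLs' : Tendsto Ls' atTop atTop) {W : ℝ}
    (hW : ∀ ε : ℝ, 0 < ε → ∀ᶠ j in atTop,
      (W - ε) * (Ls j : ℝ) ^ 2 ≤ Real.log (partitionFn β (sectorHamiltonianTT' t t' U n (Ls j))).re)
    {ε : ℝ} (hε : 0 < ε) :
    ∀ᶠ j in atTop, (W - ε) * (Ls' j : ℝ) ^ 2 ≤ Real.log (partitionFn β (sectorHamiltonianTT' t t' U n (Ls' j))).re :=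
  eventually_sub_mul_sq_le_log_partitionFn_of_le_pressureTT' hβ t t' hU hn0 hn2
    (le_pressureTT'_of_eventually_subseq hβ t t' hU hn0 hn2 hLs hW) hLs' hε

/-- **Ceiling along one `Ls` ⇒ ceiling along every `Ls'`.** [cite: Israel1979, Thm. I.2.4] -/
theorem eventually_pressureCeiling_subseq_of_subseq {Ls Ls' : ℕ → ℕ} (hLs : Tendsto Ls atTop atTop)
    (hLs' : Tendsto Ls' atTop atTop) {u : ℝ}
    (hu : ∀ ε : ℝ, 0 < ε → ∀ᶠ j in atTop,
      Real.log (partitionFn β (sectorHamiltonianTT' t t' U n (Ls j))).re ≤ (u + ε) * (Ls j : ℝ) ^ 2)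
    {ε : ℝ} (hε : 0 < ε) :
    ∀ᶠ j in atTop, Real.log (partitionFn β (sectorHamiltonianTT' t t' U n (Ls' j))).re ≤ (u + ε) * (Ls' j : ℝ) ^ 2 :=
  eventually_log_partitionFn_le_add_mul_sq_of_pressureTT'_le hβ t t' hU hn0 hn2
    (pressureTT'_le_of_eventually_subseq hβ t t' hU hn0 hn2 hLs hu) hLs' hε

/-! ### §2 Box certificates as bounds on the number -/

/-- **One open-box sector floor is a floor on the number**: `a, b ≥ 1`, `n (ab) = 2 a₀`, a certified
`0 < z ≤ Re Z_β(H^open_{a×b}(t,t',U); a₀, a₀)` ⇒ `log z/(ab) ≤ p(β; t,t',U; n)`. [cite: Ruelle1969, §3.3 (3.11)–(3.18)]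
[cite: Israel1979, Thm. I.2.4] -/
theorem log_div_le_pressureTT'_of_openBox {a b a₀ : ℕ} (ha : 1 ≤ a) (hb : 1 ≤ b)
    (hn : n * ((a : ℝ) * b) = 2 * a₀) {z : ℝ} (hz0 : 0 < z)
    (hz : z ≤ (partitionFn β (spinSectorHamiltonian a₀ a₀ (hubbardOpenBoxTT' a b t t' U))).re) :
    Real.log z / ((a : ℝ) * b) ≤ pressureTT' β t t' U n :=
  le_pressureTT'_of_eventually_subseq hβ t t' hU hn0 hn2 tendsto_id fun _ hε =>
    eventually_pressureFloor_of_openBox_allTori t t' U n hβ ha hb hn hn2.le hz0 hz tendsto_id hε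

/-- **The purity-box floor is a floor on the number**: a density matrix `ρ` on the `(a₀,a₀)` sector of the open
`a × b` box (`n (ab) = 2 a₀`) with `Re tr(ρ H^open|_{(a₀,a₀)}) ≤ E`, `Re tr(ρ²) ≤ P` ⇒ `−(log P + βE)/(ab) ≤ p`.
[cite: Ruelle1969, §3.3 (3.11)–(3.18)] [cite: Israel1979, Thm. I.2.4] -/
theorem neg_div_le_pressureTT'_of_purityBox {a b a₀ : ℕ} (ha : 1 ≤ a) (hb : 1 ≤ b)
    (hn : n * ((a : ℝ) * b) = 2 * a₀)
    {ρ : Matrix (Subtype (spinConfig (Λ := Fin a ×ₗ Fin b) a₀ a₀))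
      (Subtype (spinConfig (Λ := Fin a ×ₗ Fin b) a₀ a₀)) ℂ}
    (hρ : ρ.PosSemidef) (htr : ρ.trace = 1) {E P : ℝ}
    (hE : (ρ * spinSectorHamiltonian a₀ a₀ (hubbardOpenBoxTT' a b t t' U)).trace.re ≤ E)
    (hP : (ρ * ρ).trace.re ≤ P) :
    -(Real.log P + β * E) / ((a : ℝ) * b) ≤ pressureTT' β t t' U n :=
  le_pressureTT'_of_eventually_subseq hβ t t' hU hn0 hn2 tendsto_id fun _ hε =>
    eventually_pressureFloor_of_purityBox_allTori t t' U n hβ tendsto_id ha hb hn hn2.le hρ htr hE hP hε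

/-- **The two-box chord floor is a floor on the number**: two sectors `(p₁,p₁)`, `(p₂,p₂)` (`p₁ < p₂`) of the open
`a × b` box with certified floors `0 < z_i ≤ Re Z_β(H^open; p_i, p_i)`, `λ ∈ [0,1]`, `n (ab) = 2((1−λ)p₁ + λp₂)` ⇒
`(1−λ) log z₁/(ab) + λ log z₂/(ab) ≤ p(β; t,t',U; n)`. [cite: Ruelle1969, §3.3 (3.11)–(3.18)] [cite: Israel1979, Thm. I.2.4] -/
theorem chord_log_div_le_pressureTT'_of_twoBoxes {a b p₁ p₂ : ℕ} (ha : 1 ≤ a) (hb : 1 ≤ b) (hp : p₁ < p₂)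
    {lam : ℝ} (hlam0 : 0 ≤ lam) (hlam1 : lam ≤ 1) (hn : n * ((a : ℝ) * b) = 2 * ((1 - lam) * p₁ + lam * p₂))
    {z₁ z₂ : ℝ} (hz₁0 : 0 < z₁)
    (hz₁ : z₁ ≤ (partitionFn β (spinSectorHamiltonian p₁ p₁ (hubbardOpenBoxTT' a b t t' U))).re) (hz₂0 : 0 < z₂)
    (hz₂ : z₂ ≤ (partitionFn β (spinSectorHamiltonian p₂ p₂ (hubbardOpenBoxTT' a b t t' U))).re) :
    (1 - lam) * (Real.log z₁ / ((a : ℝ) * b)) + lam * (Real.log z₂ / ((a : ℝ) * b)) ≤ pressureTT' β t t' U n :=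
  le_pressureTT'_of_eventually_subseq hβ t t' hU hn0 hn2 tendsto_id fun _ hε =>
    eventually_pressureFloor_of_twoBoxes_allTori t t' U n hβ ha hb hp hlam0 hlam1 hn hn2 hz₁0 hz₁ hz₂0 hz₂
      tendsto_id hε

end Dictionary

end ThermodynamicLimit

/-! ### §3 The entropy rows on the number -/

namespace InfVolFermionState

section Rows

variable (t t' : ℝ) {U : ℝ} (hU : 0 ≤ U) {n : ℝ} (hn0 : 0 ≤ n) (hn2 : n < 2) {β : ℝ} (hβ : 0 < β)
  {ω : InfVolFermionState 2} {Ls : ℕ → ℕ}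
  (h : ω.IsTorusLimitOfMixture (sectorGibbsCount n) (fun L => sectorGibbsWeightTT' β t t' U n L)
    (fun L => sectorGibbsVectorTT' t t' U n L) Ls)
  (hLs : Tendsto Ls atTop atTop)
include hU hn0 hn2 hβ h hLs

/-- **The «ent» row, sharp form: `e − T·s_G ≤ f(β)`.** For every torus limit `ω` of the canonical sector Gibbs
states of `hubbardTorusTT' L t t' U` at `β > 0` along any `Ls → ∞` (`U ≥ 0`, `0 ≤ n < 2`), every rectangle
`B = ∏[0,m_i)` (`m_i > 0`) and Hermitian witness `G ∈ 𝔄_B`: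
`e_Φ(ω) − Re ω_B(G)/(β|B|) ≤ −p(β; t,t',U; n)/β + log Re Tr e^{−G}/(β|B|)`. [cite: Israel1979, Lemma II.3.1]
[cite: ArakiMoriya2003, Theorem 3.8 and §10] -/
theorem IsTorusLimitOfMixture.meanEnergy_sub_re_expect_div_le_of_sectorGibbs_box_pressureTT'
    {m : Fin 2 → ℕ} (hm : ∀ i, 0 < m i) {G : FermionOp (halfOpenRect m)} (hG : G.IsHermitian) :
    ω.meanEnergy (hubbardTTPrimeFermionInteraction t t' U) 1 -
        1 / (β * ∏ i, (m i : ℝ)) * (ω.expect (halfOpenRect m) G).re ≤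
      -pressureTT' β t t' U n / β + Real.log (partitionFn 1 G).re / (β * ∏ i, (m i : ℝ)) :=
  h.meanEnergy_sub_re_expect_div_le_of_sectorGibbs_box_of_pressureFloor t t' U hn0 hn2.le hβ hLs
    (fun _ hε => eventually_sub_mul_sq_le_log_partitionFn_of_le_pressureTT' hβ.le t t' hU hn0 hn2 le_rfl hLs hε)
    hm hG

/-- **The «ent» row with a floor on the number as input**: `W ≤ p(β; t,t',U; n)` ⇒
`e_Φ(ω) − Re ω_B(G)/(β|B|) ≤ −W/β + log Re Tr e^{−G}/(β|B|)`, for every torus limit along ANY `Ls → ∞`.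
[cite: Israel1979, Lemma II.3.1] [cite: ArakiMoriya2003, Theorem 3.8 and §10] -/
theorem IsTorusLimitOfMixture.meanEnergy_sub_re_expect_div_le_of_sectorGibbs_box_of_le_pressureTT'
    {W : ℝ} (hW : W ≤ pressureTT' β t t' U n)
    {m : Fin 2 → ℕ} (hm : ∀ i, 0 < m i) {G : FermionOp (halfOpenRect m)} (hG : G.IsHermitian) :
    ω.meanEnergy (hubbardTTPrimeFermionInteraction t t' U) 1 -
        1 / (β * ∏ i, (m i : ℝ)) * (ω.expect (halfOpenRect m) G).re ≤
      -W / β + Real.log (partitionFn 1 G).re / (β * ∏ i, (m i : ℝ)) :=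
  h.meanEnergy_sub_re_expect_div_le_of_sectorGibbs_box_of_pressureFloor t t' U hn0 hn2.le hβ hLs
    (fun _ hε => eventually_sub_mul_sq_le_log_partitionFn_of_le_pressureTT' hβ.le t t' hU hn0 hn2 hW hLs hε)
    hm hG

/-- **The «ent» row on the number, in the thermal reader's shape.** `W ≤ p(β; t,t',U; n)`, `B = ∏[0,m_i) ⊆ Λ'`,
`thicken {0} 1 ⊆ Λ'`, Hermitian `G ∈ 𝔄_B`, constants `−W/β ≤ f`, `log Re Tr e^{−G}/(β|B|) ≤ c` ⇒
`0 ≤ Re ω_{Λ'}((f + c)·1 − Γ E_Φ + (1/(β∏m_i))·Γ_{B⊆Λ'} G)` — the hypothesis `hG` of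
`…re_expect_ge_of_thermal_certificate_symm_TT'_of_sectorGibbs` for this extra row. [cite: Israel1979, Lemma II.3.1]
[cite: ArakiMoriya2003, Theorem 3.8 and §10] -/
theorem IsTorusLimitOfMixture.re_expect_entRow_nonneg_of_sectorGibbs_of_le_pressureTT'
    {W : ℝ} (hW : W ≤ pressureTT' β t t' U n)
    {m : Fin 2 → ℕ} (hm : ∀ i, 0 < m i) {G : FermionOp (halfOpenRect m)} (hG : G.IsHermitian)
    {Λ' : Finset (Site 2)} (hB : halfOpenRect m ⊆ Λ') (h0 : thicken ({0} : Finset (Site 2)) 1 ⊆ Λ')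
    {f c : ℝ} (hf : -W / β ≤ f) (hc : Real.log (partitionFn 1 G).re / (β * ∏ i, (m i : ℝ)) ≤ c) :
    0 ≤ (ω.expect Λ' ((((f + c : ℝ)) : ℂ) • (1 : FermionOp Λ') -
        fermionEmbed (PolySite.incl h0) ((hubbardTTPrimeFermionInteraction t t' U).meanEnergyObs 1) +
        ((1 / (β * ∏ i, (m i : ℝ)) : ℝ) : ℂ) • fermionEmbed (PolySite.incl hB) G)).re :=
  h.re_expect_entRow_nonneg_of_sectorGibbs_of_pressureFloor t t' U hn0 hn2.le hβ hLs
    (fun _ hε => eventually_sub_mul_sq_le_log_partitionFn_of_le_pressureTT' hβ.le t t' hU hn0 hn2 hW hLs hε)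
    hm hG hB h0 hf hc

/-- **The «cent» row, sharp form.** For every torus limit `ω` of the canonical sector Gibbs states at `β > 0`
along any `Ls → ∞` (`U ≥ 0`, `0 ≤ n < 2`), a window `Λ ⊆ [0,ℓ)²` with lexicographically largest site `a`,
`H ∈ 𝔄_Λ` and a conditional free-energy bound `S(σ) − S(σ_{Λ∖a}) − Re tr(σ H) ≤ c` for every density matrix
`σ ∈ 𝔄_Λ`: `e_Φ(ω) − Re ω_Λ(H)/β ≤ −p(β; t,t',U; n)/β + c/β`. [cite: PoulinHastings2011, eqs. (3)–(8)]
[cite: ArakiMoriya2003, Theorem 3.8 and §10] -/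
theorem IsTorusLimitOfMixture.meanEnergy_sub_re_expect_div_le_of_sectorGibbs_window_pressureTT'
    {Λ : Finset (Site 2)} {a : Site 2} (ha : a ∈ Λ) (hmax : ∀ y ∈ Λ, toLex y ≤ toLex a) {ℓ : ℕ}
    (hΛ : Λ ⊆ halfOpenBox 2 ℓ) (H : FermionOp Λ) {c : ℝ}
    (hrow : ∀ σ : FermionOp Λ, σ.PosSemidef → σ.trace = 1 →
      vonNeumannEntropy σ - vonNeumannEntropy (fermionPartialTrace (PolySite.incl (Finset.erase_subset a Λ)) σ) -
        (σ * H).trace.re ≤ c) :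
    ω.meanEnergy (hubbardTTPrimeFermionInteraction t t' U) 1 - 1 / β * (ω.expect Λ H).re ≤
      -pressureTT' β t t' U n / β + c / β :=
  h.meanEnergy_sub_re_expect_div_le_of_sectorGibbs_window_of_pressureFloor t t' U hn0 hn2.le hβ hLs
    (fun _ hε => eventually_sub_mul_sq_le_log_partitionFn_of_le_pressureTT' hβ.le t t' hU hn0 hn2 le_rfl hLs hε)
    ha hmax hΛ H hrow

/-- **The «cent» row with a floor on the number as input**: `W ≤ p(β; t,t',U; n)` and a conditional free-energy
bound `c` for `H` on the window `Λ` ⇒ `e_Φ(ω) − Re ω_Λ(H)/β ≤ −W/β + c/β`, for every torus limit along ANY `Ls → ∞`.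
[cite: PoulinHastings2011, eqs. (3)–(8)] [cite: ArakiMoriya2003, Theorem 3.8 and §10] -/
theorem IsTorusLimitOfMixture.meanEnergy_sub_re_expect_div_le_of_sectorGibbs_window_of_le_pressureTT'
    {W : ℝ} (hW : W ≤ pressureTT' β t t' U n)
    {Λ : Finset (Site 2)} {a : Site 2} (ha : a ∈ Λ) (hmax : ∀ y ∈ Λ, toLex y ≤ toLex a) {ℓ : ℕ}
    (hΛ : Λ ⊆ halfOpenBox 2 ℓ) (H : FermionOp Λ) {c : ℝ}
    (hrow : ∀ σ : FermionOp Λ, σ.PosSemidef → σ.trace = 1 →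
      vonNeumannEntropy σ - vonNeumannEntropy (fermionPartialTrace (PolySite.incl (Finset.erase_subset a Λ)) σ) -
        (σ * H).trace.re ≤ c) :
    ω.meanEnergy (hubbardTTPrimeFermionInteraction t t' U) 1 - 1 / β * (ω.expect Λ H).re ≤ -W / β + c / β :=
  h.meanEnergy_sub_re_expect_div_le_of_sectorGibbs_window_of_pressureFloor t t' U hn0 hn2.le hβ hLs
    (fun _ hε => eventually_sub_mul_sq_le_log_partitionFn_of_le_pressureTT' hβ.le t t' hU hn0 hn2 hW hLs hε)
    ha hmax hΛ H hrow

/-- **The «cent» row on the number, in the thermal reader's shape.** Same data, `Λ ⊆ Λ'`, `thicken {0} 1 ⊆ Λ'`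
and `−W/β ≤ f`: `0 ≤ Re ω_{Λ'}((f + c/β)·1 − Γ E_Φ + (1/β)·Γ_{Λ⊆Λ'} H)`. [cite: PoulinHastings2011, eqs. (3)–(8)]
[cite: ArakiMoriya2003, Theorem 3.8 and §10] -/
theorem IsTorusLimitOfMixture.re_expect_centRow_nonneg_of_sectorGibbs_of_le_pressureTT'
    {W : ℝ} (hW : W ≤ pressureTT' β t t' U n)
    {Λ : Finset (Site 2)} {a : Site 2} (ha : a ∈ Λ) (hmax : ∀ y ∈ Λ, toLex y ≤ toLex a) {ℓ : ℕ}
    (hΛℓ : Λ ⊆ halfOpenBox 2 ℓ) (H : FermionOp Λ) {c : ℝ}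
    (hrow : ∀ σ : FermionOp Λ, σ.PosSemidef → σ.trace = 1 →
      vonNeumannEntropy σ - vonNeumannEntropy (fermionPartialTrace (PolySite.incl (Finset.erase_subset a Λ)) σ) -
        (σ * H).trace.re ≤ c)
    {Λ' : Finset (Site 2)} (hΛ : Λ ⊆ Λ') (h0 : thicken ({0} : Finset (Site 2)) 1 ⊆ Λ')
    {f : ℝ} (hf : -W / β ≤ f) :
    0 ≤ (ω.expect Λ' ((((f + c / β : ℝ)) : ℂ) • (1 : FermionOp Λ') -
        fermionEmbed (PolySite.incl h0) ((hubbardTTPrimeFermionInteraction t t' U).meanEnergyObs 1) +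
        ((1 / β : ℝ) : ℂ) • fermionEmbed (PolySite.incl hΛ) H)).re :=
  h.re_expect_centRow_nonneg_of_sectorGibbs_of_pressureFloor t t' U hn0 hn2.le hβ hLs
    (fun _ hε => eventually_sub_mul_sq_le_log_partitionFn_of_le_pressureTT' hβ.le t t' hU hn0 hn2 hW hLs hε)
    ha hmax hΛℓ H hrow hΛ h0 hf

/-- **The «cent» row on the number with a Löwner dual certificate `(L_B, c)`** (`H, L_B` Hermitian,
`e^c·e^{L_B} − tr_{Λ→Λ∖a} exp(−H + Γ L_B) ⪰ 0`): `W ≤ p` ⇒ `e_Φ(ω) − Re ω_Λ(H)/β ≤ −W/β + c/β`.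
[cite: PoulinHastings2011, eqs. (3)–(8)] [cite: Lindblad1975, Lemma 2 p.149] -/
theorem IsTorusLimitOfMixture.meanEnergy_sub_re_expect_div_le_of_sectorGibbs_window_of_le_pressureTT'_of_certificate
    {W : ℝ} (hW : W ≤ pressureTT' β t t' U n)
    {Λ : Finset (Site 2)} {a : Site 2} (ha : a ∈ Λ) (hmax : ∀ y ∈ Λ, toLex y ≤ toLex a) {ℓ : ℕ}
    (hΛ : Λ ⊆ halfOpenBox 2 ℓ) {H : FermionOp Λ} (hH : H.IsHermitian) {LB : FermionOp (Λ.erase a)}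
    (hLB : LB.IsHermitian) {c : ℝ}
    (hcert : ((Real.exp c : ℂ) • cfc Real.exp LB -
      fermionPartialTrace (PolySite.incl (Finset.erase_subset a Λ))
        (cfc Real.exp (-H + fermionEmbed (PolySite.incl (Finset.erase_subset a Λ)) LB))).PosSemidef) :
    ω.meanEnergy (hubbardTTPrimeFermionInteraction t t' U) 1 - 1 / β * (ω.expect Λ H).re ≤ -W / β + c / β :=
  h.meanEnergy_sub_re_expect_div_le_of_sectorGibbs_window_of_pressureFloor_of_certificate t t' U hn0 hn2.le hβ
    hLs (fun _ hε => eventually_sub_mul_sq_le_log_partitionFn_of_le_pressureTT' hβ.le t t' hU hn0 hn2 hW hLs hε)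
    ha hmax hΛ hH hLB hcert

/-- **The «cent» row on the number with the LIEB constant** (`G ∈ 𝔄_Λ` Hermitian, `G_W = V diag(u) V⋆`,
`Z⁺ − tr_{Λ→Λ∖a} e^{−G} ⪰ 0`, `e^c·1 − dlog_{V,e^{−u}}[Z⁺] ⪰ 0`): `W ≤ p` ⇒
`e_Φ(ω) − Re ω_Λ(G − Γ G_W)/β ≤ −W/β + c/β`. [cite: Lieb1973ConvexTrace, Theorems 6–7]
[cite: PoulinHastings2011, eqs. (3)–(8)] -/
theorem IsTorusLimitOfMixture.meanEnergy_sub_re_expect_div_le_of_sectorGibbs_window_of_le_pressureTT'_lieb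
    {W : ℝ} (hW : W ≤ pressureTT' β t t' U n)
    {Λ : Finset (Site 2)} {a : Site 2} (ha : a ∈ Λ) (hmax : ∀ y ∈ Λ, toLex y ≤ toLex a) {ℓ : ℕ}
    (hΛ : Λ ⊆ halfOpenBox 2 ℓ) {G : FermionOp Λ} (hG : G.IsHermitian) {GW Zp V : FermionOp (Λ.erase a)}
    {u : Finset (Orb (PolySite (Λ.erase a))) → ℝ} {c : ℝ}
    (hV : V ∈ Matrix.unitaryGroup (Finset (Orb (PolySite (Λ.erase a)))) ℂ)
    (hGW : GW = V * diagonal (fun k => ((u k : ℝ) : ℂ)) * star V)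
    (hZ : (Zp - fermionPartialTrace (PolySite.incl (Finset.erase_subset a Λ)) (cfc Real.exp (-G))).PosSemidef)
    (hcert : (((Real.exp c : ℝ) : ℂ) • (1 : FermionOp (Λ.erase a)) -
      logFrechet V (fun k => Real.exp (-u k)) Zp).PosSemidef) :
    ω.meanEnergy (hubbardTTPrimeFermionInteraction t t' U) 1 -
        1 / β * (ω.expect Λ (G - fermionEmbed (PolySite.incl (Finset.erase_subset a Λ)) GW)).re ≤
      -W / β + c / β :=
  h.meanEnergy_sub_re_expect_div_le_of_sectorGibbs_window_of_pressureFloor_lieb t t' U hn0 hn2.le hβ hLs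
    (fun _ hε => eventually_sub_mul_sq_le_log_partitionFn_of_le_pressureTT' hβ.le t t' hU hn0 hn2 hW hLs hε)
    ha hmax hΛ hG hV hGW hZ hcert

/-- **Consistency: the zero-entropy cold input is a floor on the number** (`−β·e(t,t',U,n) ≤ p(β)`), so the rows on
the number contain those of `TorusSectorGibbsEntropyRowLimit.lean` / `TorusSectorGibbsCondEntropyRow.lean` with the
ground-state energy density input: `e_Φ(ω) − Re ω_B(G)/(β|B|) ≤ e(t,t',U,n) + log Re Tr e^{−G}/(β|B|)`.
[cite: Ruelle1969, §3.4] [cite: Israel1979, Lemma II.3.1] -/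
theorem IsTorusLimitOfMixture.meanEnergy_sub_re_expect_div_le_of_sectorGibbs_box_of_pressureTT'_mem_Icc
    {m : Fin 2 → ℕ} (hm : ∀ i, 0 < m i) {G : FermionOp (halfOpenRect m)} (hG : G.IsHermitian) :
    ω.meanEnergy (hubbardTTPrimeFermionInteraction t t' U) 1 -
        1 / (β * ∏ i, (m i : ℝ)) * (ω.expect (halfOpenRect m) G).re ≤
      energyDensityTT' t t' U n + Real.log (partitionFn 1 G).re / (β * ∏ i, (m i : ℝ)) := by
  have hrow := h.meanEnergy_sub_re_expect_div_le_of_sectorGibbs_box_of_le_pressureTT' t t' hU hn0 hn2 hβ hLs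
    (pressureTT'_mem_Icc hβ.le t t' hU hn0 hn2).1 hm hG
  have e : -(-(β * energyDensityTT' t t' U n)) / β = energyDensityTT' t t' U n := by
    field_simp
  rwa [e] at hrow

end Rows

end InfVolFermionState

end Literature.MathematicalPhysics.QuantumLattice

end
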